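import Literature.AnabelianGeometry.EtaleTheta.DoubleUnderline
import Literature.AnabelianGeometry.EtaleTheta.SingleUnderline
import Literature.AnabelianGeometry.EtaleTheta.ThetaCovers
import HarnessLib

/-!
# [EtTh] §2 in the §1 model: `X̲̲ → X̲ → X`, "extracting two copies of `ℤ/lℤ`"

Mochizuki, *The étale theta function and its Frobenioid-theoretic manifestations*, Publ. RIMS **45**
(2009), §2, Rmk. 2.3.1 (PRIMS PDF p. 38, printed 264): "one may think of the 'single underline' in
the notation `X̲^log`, `C̲^log` as denoting the result of 'extracting a single copy of `ℤ/lℤ`', and the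
'double underline' in the notation `X̲̲^log`, `C̲̲^log` as denoting the result of 'extracting two copies
of `ℤ/lℤ`'" [cite: MochizukiEtTh2009, Rmk 2.3.1 p.38]; Def. 2.5 (i) p. 39.

Cell abc-iut, layer L2, item N3 (seat abc-iut-L2-t7), the tower around the CHOICE `X̲̲`
(`EtaleThetaData.DoubleUnderline`, seat abc-iut-L2-t8, `DoubleUnderline.lean`) and the DETERMINED
`X̲` (`ThetaSetting.GtpXu`, `SingleUnderline.lean`): in the §1 model every `X̲̲` of t8's interface lies
over `X̲` — `Π^tp_X̲̲ ⊆ Π^tp_X̲ = toZ⁻¹(l·Z)` (`Huu_le_GtpXu`, from the field `map_toZ_Huu`),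
`Π^tp_X̲̲ · Π^tp_Y = Π^tp_X̲` (`Huu_sup_GtpY`), hence "`X̲̲ → X̲` extracts the second copy of `ℤ/lℤ`":
`[Π^tp_X̲ : Π^tp_X̲̲] = l` (`relIndex_Huu_GtpXu`, from "`Y̲̲ → Y` of degree `l`") and
`[Π^tp_X : Π^tp_X̲̲] = l²` (`index_Huu`). All PROVED from t8's fields and the root axioms; no new data,
no named fact. Nothing here asserts that such data exist; typed ≠ endorsed; no side is taken on any
disputed claim.
-/

noncomputable section

namespace Literature.AnabelianGeometry.EtaleTheta

open Literature.AnabelianGeometry.SemiGraphs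

namespace ThetaSetting

namespace EtaleThetaData.DoubleUnderline

variable {p : ℕ} [Fact p.Prime] {D : ThetaSetting p} {E : D.EtaleThetaData} {l : ℕ}
  (C : E.DoubleUnderline l)

/-- **`Π^tp_X̲̲ ⊆ Π^tp_X̲`**: the chosen `X̲̲` lies over the determined `X̲ = toZ⁻¹(l·Z)` (Def. 2.5 (i)(a):
"the quotient … factors through the natural quotient `Π^tp_X ↠ Z`"; field `map_toZ_Huu`).
[cite: MochizukiEtTh2009, Def 2.5 (i) p.39] -/
theorem Huu_le_GtpXu : C.Huu ≤ D.GtpXu l := by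
  intro h hh
  have hz : D.toZ h ∈ C.Huu.map D.toZ := ⟨h, hh, rfl⟩
  rw [C.map_toZ_Huu] at hz
  exact hz

/-- `Π^tp_X̲̲ · Π^tp_Y = Π^tp_X̲` (both sides map onto `l·Z` with `Π^tp_Y = Ker(toZ)`).
[cite: MochizukiEtTh2009, Def 2.5 (i) p.39] -/
theorem Huu_sup_GtpY : C.Huu ⊔ D.GtpY = D.GtpXu l := by
  refine le_antisymm (sup_le C.Huu_le_GtpXu (D.GtpY_le_GtpXu l)) ?_
  intro g hg
  have hz : D.toZ g ∈ C.Huu.map D.toZ := by rw [C.map_toZ_Huu]; exact hg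
  obtain ⟨h, hh, hhg⟩ := hz
  have hmem : h⁻¹ * g ∈ D.GtpY := by
    change D.toZ (h⁻¹ * g) = 1
    rw [map_mul, map_inv, hhg, inv_mul_cancel]
  have : g = h * (h⁻¹ * g) := by group
  rw [this]
  exact Subgroup.mul_mem _ (Subgroup.mem_sup_left hh) (Subgroup.mem_sup_right hmem)

/-- **`[Π^tp_X̲ : Π^tp_X̲̲] = l`** — "`X̲̲ → X̲` extracts the second copy of `ℤ/lℤ`" (Rmk. 2.3.1), from
"`Y̲̲ → Y` of degree `l`" (field `relIndex_Huu_GtpY`) and `Π^tp_X̲̲ · Π^tp_Y = Π^tp_X̲`.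
[cite: MochizukiEtTh2009, Rmk 2.3.1 p.38] -/
theorem relIndex_Huu_GtpXu : C.Huu.relIndex (D.GtpXu l) = l := by
  haveI : D.GtpY.Normal := by change D.toZ.ker.Normal; infer_instance
  rw [← C.Huu_sup_GtpY, ThetaCovers.CoverData.relIndex_sup_eq_relIndex_of_normal,
    ← Subgroup.inf_relIndex_right]
  exact C.relIndex_Huu_GtpY

/-- **`[Π^tp_X : Π^tp_X̲̲] = l²`** — "extracting two copies of `ℤ/lℤ`" (Rmk. 2.3.1):
`[Π^tp_X : Π^tp_X̲] · [Π^tp_X̲ : Π^tp_X̲̲] = l · l`. [cite: MochizukiEtTh2009, Rmk 2.3.1 p.38] -/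
theorem index_Huu : C.Huu.index = l ^ 2 := by
  rw [← Subgroup.relIndex_mul_index C.Huu_le_GtpXu, C.relIndex_Huu_GtpXu, D.index_GtpXu, sq]

/-- The image of `Π^tp_X̲̲` in `G_K` is all of `G_K`, as is that of `Π^tp_X̲` (geometric connectedness
of `X̲̲ → X̲ → X`). [cite: MochizukiEtTh2009, Prop 2.2 (iii) p.37] -/
theorem map_aug_Huu_eq_map_aug_GtpXu :
    C.Huu.map D.aug.toMonoidHom = (D.GtpXu l).map D.aug.toMonoidHom := by
  rw [C.map_aug_Huu, D.map_aug_GtpXu]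

end EtaleThetaData.DoubleUnderline

end ThetaSetting

end Literature.AnabelianGeometry.EtaleTheta

end
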